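import Mathlib.RingTheory.HopkinsLevitzki
import Mathlib.RingTheory.Ideal.Quotient.Noetherian
import Mathlib.RingTheory.Artinian.Module
import Mathlib.RingTheory.Artinian.Ring
import Mathlib.GroupTheory.FiniteAbelian.Basic
import Mathlib.Data.Fintype.Pigeonhole
import Mathlib.Algebra.Polynomial.Roots
import Mathlib.RingTheory.IntegralDomain
import Mathlib.SetTheory.Cardinal.Finite
import HarnessLib

/-!
# In a Noetherian ring, the number of ideals having a given finite norm is finite (Samuel 1971, Prop. 13)

Topic `Literature/RingTheory/Ideal`, namespace `Literature.RingTheory.Ideal`.  THEOREMS ONLY (no `def`, no instance, no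
named fact), all proved.  The norm of an ideal `𝔟` of a ring `A` is Samuel's `n(𝔟) = card(A/𝔟)`, written
`Nat.card (A ⧸ I)` (so «finite norm `n`» means `Nat.card (A ⧸ I) = n` with `n ≠ 0`).

## Source (read at the page)

P. Samuel, *About Euclidean rings*, J. Algebra **19** (1971) 282–301 [Samuel1971] (materialised
`paper:doi-10-1016-0021-8693-71-90110-4`), §5, p. 291: «we define the norm `n(𝔟)` of an ideal `𝔟` in a ring `A` as the
cardinal number `card(A/𝔟)`»; p. 292, VERBATIM: «PROPOSITION 13. In a noetherian ring `A`, the number of ideals having a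
given finite norm is finite.  Let `n` be this norm.  The number of isomorphism classes of rings with `n` elements being
finite, it is sufficient to show that, if `R` is a given finite ring, the family `(𝔟ᵢ)_{i∈I}` of ideals `𝔟ᵢ ⊂ A` with
`A/𝔟ᵢ ≃ R` is finite.  Let `𝔟 = ⋂ᵢ 𝔟ᵢ`.  We have an injective homomorphism `A/𝔟 → ∏ᵢ A/𝔟ᵢ = R^I`.  Now let `(𝔪ⱼ)` be
the maximal ideals of `R`; set `qⱼ = card(R/𝔪ⱼ)`, and let `s` be an exponent such that `(𝔪₁ ⋯ 𝔪_r)^s = 0`.  We then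
have, for every `x` in `R`, `P(x) = ∏ⱼ (x^{qⱼ} − x)^s = 0` (5.1).  This relation holds also for every `x` in `R^I`,
whence for every element of `B = A/𝔟`.  Now `B` is noetherian, and there is a monic polynomial `P(X)` over `ℤ` such
that `P(b) = 0` for every `b ∈ B`.  Since a nonzero polynomial has only a finite number of roots in an integral domain,
we see that `B/𝔭` is finite for every prime ideal `𝔭` of `B`.  In particular `B/𝔭` is a field, `𝔭` is maximal and
`B` is Artinian.  Since its residue fields are finite, and since `B` has finite length, `B` is a finite ring.  The
correspondence between the ideals of `B = A/𝔟` and the ideals of `A` containing `𝔟` shows that the latter ones form a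
finite set.  Hence the family `(𝔟ᵢ)_{i∈I}` is finite. Q.E.D.»

## What is formalised (the printed proof, with one simplification)

* The universal identity: Samuel's `P(x) = ∏ⱼ (x^{qⱼ} − x)^s` (which requires the structure of the finite ring `R`) is
  replaced by the pigeonhole identity **`x^{n + n!} = x^n`**, valid in EVERY finite monoid with `n` elements
  (`pow_card_add_factorial`), together with `n · 1 = 0`; both hold in `A/𝔟ᵢ` for every ideal of norm `n`, hence modulo
  `𝔟 =` the ideal `J` generated by `n` and the elements `a^{n+n!} − a^n` (`le_of_natCard_quotient_eq`) — so the
  reduction to a fixed finite ring `R` («the number of isomorphism classes … being finite») is not needed.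
* «`B/𝔭` is finite for every prime ideal `𝔭` of `B`» (the non-zero elements of the domain `B/𝔭` are roots of
  `X^{n!} − 1`): `finite_of_pow_eq_pow`, `isMaximal_of_isPrime_of_span_le`; «`𝔭` is maximal and `B` is Artinian»:
  `isArtinianRing_of_span_le` (Noetherian of Krull dimension `0`); «Since its residue fields are finite, and since `B`
  has finite length, `B` is a finite ring»: **`finite_quotient_of_span_le`** — via Hopkins–Levitzki (`B` is
  module-finite over `ℤ` because `B/Jac(B) ≅ ∏ B/𝔪` is finite) and `n · B = 0` (a finitely generated torsion abelian
  group is finite).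
* **Proposition 13**: **`finite_setOf_natCard_quotient_eq`** (`{I | card(A/I) = n}` is finite for `n ≠ 0`) and the
  form used by Samuel's Remark (F): **`finite_setOf_natCard_quotient_le`** (finitely many ideals of finite norm `≤ N`).

## Mathlib / tree search

Mathlib: `Fintype.exists_ne_map_eq_of_card_lt` (pigeonhole), `Nat.dvd_factorial`, `card_nsmul_eq_zero'`,
`Polynomial.mem_nthRoots` / `Multiset.toFinset`, `Finite.isField_of_domain`, `Ideal.Quotient.maximal_of_isField`,
`Ring.krullDimLE_zero_iff`, `isArtinianRing_iff_krullDimLE_zero`, `IsArtinianRing.quotNilradicalEquivPi`,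
`IsArtinianRing.jacobson_eq_radical`, `Ideal.jacobson_bot`, `IsSemiprimaryRing.finite_of_isNoetherian` (Hopkins–Levitzki),
`Module.finite_of_fg_torsion`, `Ideal.comap_map_of_surjective`; no statement counting ideals of given index
(`rg "Nat.card (. ⧸" Mathlib/RingTheory/Ideal` → nothing of the kind).  Tree: `rg "finite norm|IdealsOfFiniteNorm"` →
nothing; `Literature/Algebra/EuclideanDomain/TransfiniteSmallestAlgorithm.lean` records Samuel's Remark (F) as a TODO
pending this proposition.
-/

namespace Literature.RingTheory.Ideal

open Polynomial

universe u

/-! ## §1 The universal identity `x^{n + n!} = x^n` in a finite monoid with `n` elements -/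

/-- **Pigeonhole identity**: in a finite monoid with `n` elements, `x^{n + n!} = xⁿ` for every `x` (two of
`x, x², …, x^{n+1}` coincide, `x^{a+1} = x^{a+1+d}` with `1 ≤ d ≤ n`, so `d ∣ n!`).  This replaces Samuel's
`P(x) = ∏ⱼ (x^{qⱼ} − x)^s = 0`, «a monic polynomial `P(X)` over `ℤ` such that `P(b) = 0`». [cite: Samuel1971, Prop. 13
(proof, (5.1), p. 292)] -/
theorem pow_card_add_factorial {F : Type*} [Monoid F] [Finite F] (x : F) :
    x ^ (Nat.card F + (Nat.card F).factorial) = x ^ Nat.card F := by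
  classical
  haveI := Fintype.ofFinite F
  set n := Nat.card F with hn
  have hcard : Fintype.card F = n := Fintype.card_eq_nat_card
  obtain ⟨i, j, hij, heq⟩ := Fintype.exists_ne_map_eq_of_card_lt (fun k : Fin (n + 1) ↦ x ^ (k.1 + 1))
    (by rw [hcard, Fintype.card_fin]; exact Nat.lt_succ_self n)
  -- wlog `i < j`
  have key : ∀ a b : ℕ, a < b → b ≤ n → x ^ (a + 1) = x ^ (b + 1) → x ^ (n + n.factorial) = x ^ n := by
    intro a b hab hbn hxab
    set d := b - a with hd
    have hd0 : 0 < d := by omega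
    have hdn : d ≤ n := by omega
    have hper : ∀ k : ℕ, x ^ (a + 1 + k * d) = x ^ (a + 1) := by
      intro k
      induction k with
      | zero => rw [zero_mul, add_zero]
      | succ k ih =>
        have hk : a + 1 + (k + 1) * d = (b + 1) + k * d := by rw [Nat.add_mul, one_mul]; omega
        rw [hk, pow_add, ← hxab, ← pow_add, ih]
    obtain ⟨c, hc⟩ := Nat.dvd_factorial hd0 hdn
    have h1 : x ^ (a + 1 + n.factorial) = x ^ (a + 1) := by
      rw [hc, mul_comm d c]
      exact hper c
    rw [show n + n.factorial = (a + 1 + n.factorial) + (n - (a + 1)) by omega, pow_add, h1, ← pow_add]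
    congr 1
    omega
  have hi := i.2
  have hj := j.2
  rcases lt_or_gt_of_ne (fun h : i.1 = j.1 ↦ hij (Fin.ext h)) with h | h
  · exact key i.1 j.1 h (by omega) heq
  · exact key j.1 i.1 h (by omega) heq.symm

/-! ## §2 The universal ideal `J` below every ideal of norm `n`, and the finiteness of `A/J` -/

section Noetherian

variable {A : Type u} [CommRing A]

/-- Every ideal `I` of norm `n = card(A/I)` (finite, so `n ≠ 0`) contains `n · 1` and all `a^{n+n!} − aⁿ`: it contains
the ideal `J` they generate (Samuel's `𝔟 = ⋂ᵢ 𝔟ᵢ` contains this `J`, which is all the proof uses).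
[cite: Samuel1971, Prop. 13 (proof, p. 292)] -/
theorem le_of_natCard_quotient_eq {n : ℕ} (hn : n ≠ 0) {I : Ideal A} (hI : Nat.card (A ⧸ I) = n) :
    Ideal.span ({(n : A)} ∪ Set.range fun a : A ↦ a ^ (n + n.factorial) - a ^ n) ≤ I := by
  haveI : Finite (A ⧸ I) := Nat.finite_of_card_ne_zero (hI ▸ hn)
  rw [Ideal.span_le]
  rintro x (rfl | ⟨a, rfl⟩)
  · -- `n · 1 = 0` in the additive group `A/I` of order `n`
    rw [SetLike.mem_coe, ← Ideal.Quotient.eq_zero_iff_mem, map_natCast]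
    have h : Nat.card (A ⧸ I) • (1 : A ⧸ I) = 0 := card_nsmul_eq_zero'
    rwa [hI, nsmul_eq_mul, mul_one] at h
  · rw [SetLike.mem_coe, ← Ideal.Quotient.eq_zero_iff_mem, map_sub, map_pow, map_pow, sub_eq_zero]
    have h := pow_card_add_factorial (Ideal.Quotient.mk I a)
    rwa [hI] at h

/-- In `B = A/J` every element satisfies `b^{n+n!} = bⁿ` and `n · 1 = 0`; the same holds in every quotient of `B`.
[cite: Samuel1971, Prop. 13 (proof, p. 292: «This relation holds … for every element of `B = A/𝔟`»)] -/
theorem pow_eq_pow_of_span_le {n : ℕ} {K : Ideal A}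
    (hK : Ideal.span ({(n : A)} ∪ Set.range fun a : A ↦ a ^ (n + n.factorial) - a ^ n) ≤ K) (b : A ⧸ K) :
    b ^ (n + n.factorial) = b ^ n ∧ (n : A ⧸ K) = 0 := by
  obtain ⟨a, rfl⟩ := Ideal.Quotient.mk_surjective b
  constructor
  · rw [← map_pow, ← map_pow, ← sub_eq_zero, ← map_sub, Ideal.Quotient.eq_zero_iff_mem]
    exact hK (Ideal.subset_span (Or.inr ⟨a, rfl⟩))
  · rw [← map_natCast (Ideal.Quotient.mk K), Ideal.Quotient.eq_zero_iff_mem]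
    exact hK (Ideal.subset_span (Or.inl rfl))

/-- **«`B/𝔭` is finite for every prime ideal `𝔭` of `B`»** («Since a nonzero polynomial has only a finite number of
roots in an integral domain»): in a domain where `b^{n+n!} = bⁿ` for all `b`, every non-zero element is a root of
`X^{n!} − 1`. [cite: Samuel1971, Prop. 13 (proof, p. 292)] -/
theorem finite_of_pow_eq_pow {D : Type*} [CommRing D] [IsDomain D] {n : ℕ}
    (h : ∀ b : D, b ^ (n + n.factorial) = b ^ n) : Finite D := by
  classical
  have hfac : 0 < n.factorial := Nat.factorial_pos n
  -- `D ⊆ {0} ∪ nthRoots n! 1`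
  let S : Finset D := insert 0 (Polynomial.nthRoots n.factorial (1 : D)).toFinset
  refine Finite.of_injective (fun d : D ↦ (⟨d, ?_⟩ : S)) fun a b hab ↦ by simpa using hab
  rw [Finset.mem_insert, Multiset.mem_toFinset, Polynomial.mem_nthRoots hfac]
  by_cases hd : d = 0
  · exact Or.inl hd
  · right
    have h1 : d ^ n * (d ^ n.factorial - 1) = 0 := by rw [mul_sub, mul_one, ← pow_add, h d, sub_self]
    rcases mul_eq_zero.1 h1 with h2 | h2
    · exact absurd (pow_eq_zero_iff' |>.1 h2).1 hd
    · exact sub_eq_zero.1 h2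

/-- Every prime ideal of `B = A/K` (`J ≤ K`) has a finite residue ring, hence is maximal («In particular `B/𝔭` is a
field, `𝔭` is maximal»). [cite: Samuel1971, Prop. 13 (proof, p. 292)] -/
theorem isMaximal_of_isPrime_of_span_le {n : ℕ} {K : Ideal A}
    (hK : Ideal.span ({(n : A)} ∪ Set.range fun a : A ↦ a ^ (n + n.factorial) - a ^ n) ≤ K)
    (P : Ideal (A ⧸ K)) [hP : P.IsPrime] : Finite ((A ⧸ K) ⧸ P) ∧ P.IsMaximal := by
  have hpow : ∀ b : (A ⧸ K) ⧸ P, b ^ (n + n.factorial) = b ^ n := by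
    intro b
    obtain ⟨c, rfl⟩ := Ideal.Quotient.mk_surjective b
    rw [← map_pow, ← map_pow, (pow_eq_pow_of_span_le hK c).1]
  haveI : Finite ((A ⧸ K) ⧸ P) := finite_of_pow_eq_pow hpow
  exact ⟨this, Ideal.Quotient.maximal_of_isField P (Finite.isField_of_domain ((A ⧸ K) ⧸ P))⟩

/-- «`𝔭` is maximal and `B` is Artinian» — `B` is Noetherian of Krull dimension `0`.
[cite: Samuel1971, Prop. 13 (proof, p. 292)] -/
theorem isArtinianRing_of_span_le [IsNoetherianRing A] {n : ℕ} {K : Ideal A}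
    (hK : Ideal.span ({(n : A)} ∪ Set.range fun a : A ↦ a ^ (n + n.factorial) - a ^ n) ≤ K) :
    IsArtinianRing (A ⧸ K) := by
  haveI : IsNoetherianRing (A ⧸ K) := inferInstance
  rw [isArtinianRing_iff_krullDimLE_zero, Ring.krullDimLE_zero_iff]
  intro P hP
  exact (isMaximal_of_isPrime_of_span_le hK P).2

/-- **«Since its residue fields are finite, and since `B` has finite length, `B` is a finite ring»** (for `n ≠ 0`): here
via Hopkins–Levitzki — `B/Jac(B) ≅ ∏_𝔪 B/𝔪` is finite, so the Noetherian `B`-module `B` is finitely generated over `ℤ`,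
and it is killed by `n`. [cite: Samuel1971, Prop. 13 (proof, p. 292)] -/
theorem finite_quotient_of_span_le [IsNoetherianRing A] {n : ℕ} (hn : n ≠ 0) {K : Ideal A}
    (hK : Ideal.span ({(n : A)} ∪ Set.range fun a : A ↦ a ^ (n + n.factorial) - a ^ n) ≤ K) :
    Finite (A ⧸ K) := by
  haveI hArt : IsArtinianRing (A ⧸ K) := isArtinianRing_of_span_le hK
  -- the residue fields are finite, and there are finitely many of them
  haveI : ∀ m : MaximalSpectrum (A ⧸ K), Finite ((A ⧸ K) ⧸ m.asIdeal) := fun m ↦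
    (isMaximal_of_isPrime_of_span_le hK m.asIdeal (hP := m.isMaximal.isPrime)).1
  have hfinJ : Finite ((A ⧸ K) ⧸ Ring.jacobson (A ⧸ K)) := by
    have hJ : Ring.jacobson (A ⧸ K) = nilradical (A ⧸ K) := by
      rw [← Ideal.jacobson_bot, IsArtinianRing.jacobson_eq_radical]; rfl
    haveI : Finite ((A ⧸ K) ⧸ nilradical (A ⧸ K)) :=
      Finite.of_equiv _ (IsArtinianRing.quotNilradicalEquivPi (A ⧸ K)).toEquiv.symm
    exact Finite.of_equiv _ (Ideal.quotEquivOfEq hJ.symm).toEquiv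
  haveI : Module.Finite ℤ ((A ⧸ K) ⧸ Ring.jacobson (A ⧸ K)) := Module.Finite.of_finite
  haveI : Module.Finite ℤ (A ⧸ K) := IsSemiprimaryRing.finite_of_isNoetherian ℤ (A ⧸ K) (A ⧸ K)
  -- `n · B = 0`: a finitely generated torsion abelian group is finite
  refine Module.finite_of_fg_torsion (A ⧸ K) fun b ↦ ?_
  refine ⟨⟨(n : ℤ), mem_nonZeroDivisors_of_ne_zero (by exact_mod_cast hn)⟩, ?_⟩
  change (n : ℤ) • b = 0
  rw [zsmul_eq_mul, Int.cast_natCast, (pow_eq_pow_of_span_le hK b).2, zero_mul]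

end Noetherian

/-! ## §3 Proposition 13 -/

section PropThirteen

variable {A : Type u} [CommRing A] [IsNoetherianRing A]

/-- **Proposition 13.** «In a noetherian ring `A`, the number of ideals having a given finite norm is finite»: for
`n ≠ 0`, the ideals `I` with `card(A/I) = n` form a finite set (they all contain the universal ideal `J`, and the
ideals of the finite ring `A/J` are finitely many: «The correspondence between the ideals of `B = A/𝔟` and the ideals
of `A` containing `𝔟` shows that the latter ones form a finite set»). [cite: Samuel1971, Prop. 13 (p. 292)] -/
theorem finite_setOf_natCard_quotient_eq (n : ℕ) (hn : n ≠ 0) :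
    {I : Ideal A | Nat.card (A ⧸ I) = n}.Finite := by
  set J : Ideal A := Ideal.span ({(n : A)} ∪ Set.range fun a : A ↦ a ^ (n + n.factorial) - a ^ n) with hJ
  haveI : Finite (A ⧸ J) := finite_quotient_of_span_le hn le_rfl
  haveI : Finite (Ideal (A ⧸ J)) :=
    Finite.of_injective (fun I : Ideal (A ⧸ J) ↦ (I : Set (A ⧸ J))) SetLike.coe_injective
  -- `I ↦ I·(A/J)` is injective on the ideals containing `J`
  refine Set.Finite.of_finite_image (Set.toFinite _) (f := fun I : Ideal A ↦ I.map (Ideal.Quotient.mk J)) ?_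
  intro I hI I' hI' h
  have hJI : J ≤ I := le_of_natCard_quotient_eq hn hI
  have hJI' : J ≤ I' := le_of_natCard_quotient_eq hn hI'
  have key : ∀ K : Ideal A, J ≤ K → Ideal.comap (Ideal.Quotient.mk J) (K.map (Ideal.Quotient.mk J)) = K := by
    intro K hK
    rw [Ideal.comap_map_of_surjective _ Ideal.Quotient.mk_surjective, ← RingHom.ker_eq_comap_bot,
      Ideal.mk_ker, sup_eq_left.2 hK]
  simp only at h
  rw [← key I hJI, ← key I' hJI', h]

/-- The form used for Samuel's Remark (F): **finitely many ideals of finite norm at most `N`**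
(`0 < card(A/I) ≤ N`; `Nat.card = 0` encodes an infinite quotient). [cite: Samuel1971, Prop. 13 (p. 292) and §3 Remark
(F) (p. 286)] -/
theorem finite_setOf_natCard_quotient_le (N : ℕ) :
    {I : Ideal A | 0 < Nat.card (A ⧸ I) ∧ Nat.card (A ⧸ I) ≤ N}.Finite := by
  have h : {I : Ideal A | 0 < Nat.card (A ⧸ I) ∧ Nat.card (A ⧸ I) ≤ N} ⊆
      ⋃ n ∈ Finset.Icc 1 N, {I : Ideal A | Nat.card (A ⧸ I) = n} := by
    intro I hI
    simp only [Set.mem_setOf_eq] at hI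
    simp only [Set.mem_iUnion, Set.mem_setOf_eq, Finset.mem_Icc, exists_prop]
    exact ⟨Nat.card (A ⧸ I), ⟨hI.1, hI.2⟩, rfl⟩
  refine Set.Finite.subset ?_ h
  exact Set.Finite.biUnion (Finset.finite_toSet _) fun n hn ↦
    finite_setOf_natCard_quotient_eq n (by simp only [Finset.coe_Icc, Set.mem_Icc] at hn; omega)

/-- Finitely many ideals with a FINITE quotient of cardinality at most `N` (the same statement with `Finite`).
[cite: Samuel1971, Prop. 13 (p. 292)] -/
theorem finite_setOf_finite_quotient_natCard_le (N : ℕ) :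
    {I : Ideal A | Finite (A ⧸ I) ∧ Nat.card (A ⧸ I) ≤ N}.Finite := by
  refine (finite_setOf_natCard_quotient_le N).subset fun I hI ↦ ?_
  obtain ⟨hfin, hle⟩ := hI
  haveI := hfin
  exact ⟨Nat.card_pos, hle⟩

end PropThirteen

end Literature.RingTheory.Ideal
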